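import Summits.Ventures.PercRepro.GenQHyperplaneRowsB
import Summits.Ventures.PercRepro.GenQTraceProfileB

/-!
# PercRepro — the flat-lattice counting rows, part F: two traces of one size share `2s − n` points (night-4, gen 11)

Two distinct rank-`(q − 1)` flats with `s`-point spanning traces meet in a flat of rank `≤ q − 2` containing at least
`2s − n` points of `G`, and no `j`-subset of that intersection spans either flat.  So when `h_s ≥ 2` every `s`-trace
loses `≥ C(2s − n, j)` of its `C(s, j)` `j`-subsets as non-spanning:

`SP_{s,j} + C(2s − n, j)·(h_s − 1) ≤ C(s, j)·h_s`   (`gs_row`; for `h_s ≤ 1` this is (H3)),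

the row (G-S) of the two-level profile LP (sheet §65 (b)).  Imports `GenQHyperplaneRowsB`, `GenQTraceProfileB`.
-/
namespace PercRepro.Night4

open Finset ThmH SixFour GenQ PerFlat Star

variable {α : Type*} [DecidableEq α] {M : Matroid α} [M.Finite]

/-- The spanning `j`-subsets of the trace of `H` avoid the trace of any other rank-`(q−1)` flat `H′`:
`spF H j + C(|H ∩ H′ ∩ G|, j) ≤ C(|H ∩ G|, j)`. -/
theorem spF_add_choose_inter_le {G H H' : Finset α} {q : ℕ} (hH : H ∈ flatsQ M (q + 1)) (hH' : H' ∈ flatsQ M (q + 1))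
    (hne : H ≠ H') (j : ℕ) :
    spF M G H (q + 1) j + ((H ∩ H') ∩ G).card.choose j ≤ (H ∩ G).card.choose j := by
  classical
  obtain ⟨a, hKa, har⟩ := inter_mem_flatsQ_of_ne' hH hH' hne
  unfold spF
  rw [← Finset.card_powersetCard, ← Finset.card_powersetCard]
  -- the two families are disjoint subfamilies of the `j`-subsets of `H ∩ G`
  have hsub1 : ((H ∩ G).powersetCard j).filter (fun T : Finset α => M.eRk (T : Set α) = ((q + 1 : ℕ) : ℕ∞))
      ⊆ (H ∩ G).powersetCard j := Finset.filter_subset _ _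
  have hsub2 : ((H ∩ H') ∩ G).powersetCard j ⊆ (H ∩ G).powersetCard j := by
    refine Finset.powersetCard_mono ?_
    intro x hx
    simp only [Finset.mem_inter] at hx ⊢
    exact ⟨hx.1.1, hx.2⟩
  have hdisj : Disjoint (((H ∩ G).powersetCard j).filter (fun T : Finset α => M.eRk (T : Set α) = ((q + 1 : ℕ) : ℕ∞)))
      (((H ∩ H') ∩ G).powersetCard j) := by
    rw [Finset.disjoint_left]
    intro T hT hT'
    rw [Finset.mem_filter] at hT
    rw [Finset.mem_powersetCard] at hT'
    -- `T ⊆ H ∩ H′` has rank `≤ a ≤ q < q + 1`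
    have hle : M.eRk (T : Set α) ≤ (a : ℕ∞) := by
      rw [← (mem_flatsQ.1 hKa).2.2]
      exact M.eRk_mono (Finset.coe_subset.2 (hT'.1.trans Finset.inter_subset_left))
    rw [hT.2] at hle
    have h1 : q + 1 ≤ a := by exact_mod_cast hle
    omega
  rw [← Finset.card_union_of_disjoint hdisj]
  exact Finset.card_le_card (Finset.union_subset hsub1 hsub2)

/-- **(G-S)**: `SP_{s,j} + C(2s − n, j)·(h_s − 1) ≤ C(s, j)·h_s` (`2 ≤ q`). -/
theorem gs_row {G : Finset α} {q : ℕ} (hq : 2 ≤ q) (s j : ℕ) :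
    spSum M G (q - 1) s j + (2 * s - G.card).choose j * (hypTr M G (q - 1) s - 1)
      ≤ s.choose j * hypTr M G (q - 1) s := by
  classical
  rcases Nat.lt_or_ge (hypTr M G (q - 1) s) 2 with hlt | hge
  · -- `h_s ≤ 1`: (H3)
    have h0 : hypTr M G (q - 1) s - 1 = 0 := by omega
    rw [h0, mul_zero, add_zero]
    exact spSum_le_choose_mul_hypTr G (q - 1) s j
  · -- `h_s ≥ 2`: every trace loses `≥ C(2s − n, j)` subsets
    have hq' : q - 2 + 1 = q - 1 := by omega
    have hper : ∀ H ∈ flatsTr M G (q - 1) s, spF M G H (q - 1) j + (2 * s - G.card).choose j ≤ s.choose j := by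
      intro H hH
      -- another trace `H′ ≠ H`
      have hcard : 1 < (flatsTr M G (q - 1) s).card := hge
      obtain ⟨H', hH', hne⟩ := Finset.exists_mem_ne hcard H
      have hH1 := mem_flatsTr.1 hH
      have hH1' := mem_flatsTr.1 hH'
      have hHq : H ∈ flatsQ M (q - 2 + 1) := by rw [hq']; exact hH1.1
      have hHq' : H' ∈ flatsQ M (q - 2 + 1) := by rw [hq']; exact hH1'.1
      have h1 := spF_add_choose_inter_le (G := G) hHq hHq' (Ne.symm hne) j
      rw [hq', hH1.2.1] at h1
      -- `|H ∩ H′ ∩ G| ≥ 2s − n`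
      have hsub : (H ∩ G) ∩ (H' ∩ G) ⊆ (H ∩ H') ∩ G := by
        intro x hx
        simp only [Finset.mem_inter] at hx ⊢
        exact ⟨⟨hx.1.1, hx.2.1⟩, hx.1.2⟩
      have hsub2 : (H ∩ G) ∪ (H' ∩ G) ⊆ G := by
        intro x hx
        simp only [Finset.mem_union, Finset.mem_inter] at hx
        rcases hx with hx | hx
        · exact hx.2
        · exact hx.2
      have h2 := Finset.card_union_add_card_inter (H ∩ G) (H' ∩ G)
      have h3 := Finset.card_le_card hsub2
      have h4 := Finset.card_le_card hsub
      rw [hH1.2.1, hH1'.2.1] at h2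
      have h5 : 2 * s - G.card ≤ ((H ∩ H') ∩ G).card := by omega
      have h6 := Nat.choose_le_choose j h5
      omega
    -- sum over the traces
    have hsum : ∑ H ∈ flatsTr M G (q - 1) s, (spF M G H (q - 1) j + (2 * s - G.card).choose j)
        ≤ ∑ H ∈ flatsTr M G (q - 1) s, s.choose j := Finset.sum_le_sum hper
    rw [Finset.sum_add_distrib, Finset.sum_const, Finset.sum_const, smul_eq_mul, smul_eq_mul] at hsum
    unfold spSum hypTr
    have h7 : (2 * s - G.card).choose j * ((flatsTr M G (q - 1) s).card - 1)
        ≤ (flatsTr M G (q - 1) s).card * (2 * s - G.card).choose j := by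
      rw [mul_comm]
      exact Nat.mul_le_mul_right _ (Nat.sub_le _ _)
    rw [mul_comm (s.choose j)]
    omega

end PercRepro.Night4
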